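import Summits.HubbardSuperconductivity.HubbardSuperconductivity.Theorems.ParentFirstSMAMottGap

/-!
# Crux `HoleSingleModeBelowHalfU` (route `ParentFirstSMA`): the sorry-free spine of line `birth`

Support file for item stmt-HubbardSuperconductivity-10769 (`HoleSingleModeBelowHalfU`, crux #2 of route
`ParentFirstSMA`, sub-problem `HubbardSuperconductivity`). Line `birth`
(`Cruxes/HoleSingleModeBelowHalfU/Lines/birth.lean`) cuts the crux as

  [parent Mott gap on the window `U ∈ [12, 24]`] × [pole-dominated refill of the one-hole ground state],

and this file machine-checks everything about that cut that is provable today: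

* `refill_budget_of_pole` — the real arithmetic of the composition (`ε := θ·g·c`);
* `chargeGap_eq_slack` — on the even torus the Lieb–Wu charge gap at half filling is the pole's slack,
  `Δ_c(L) = U − 2 (E(L²) − E(L² − 1))`, from the proved particle–hole identity
  `groundEnergyAt_fermionTorus_particleHole`;
* `holeSingleModeBelowHalfU_of_gap_of_pole` — the composition: the two stub statements of line `birth`, taken
  as explicit hypotheses (spelled out verbatim), imply the crux BY NAME;
* `parentMottGap_of_holeSingleModeBelowHalfU` — NECESSITY of the first stub: the crux implies the parent Mott
  gap on the window (via the landed `mottGapFromSingleMode_proof`), i.e. every line of this crux must prove the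
  L-uniform charge gap of the half-filled two-dimensional Hubbard torus for `U ∈ [12, 24]` — the open problem
  recorded by the barrier `Literature.Barriers.HubbardSuperconductivity.StrongCouplingCeiling`;
* `diluteDWavePairsCondense_gap_hypothesis_of_holeSingleModeBelowHalfU` — the same conclusion in the exact
  shape of hypothesis (a) of crux #4 `DiluteDWavePairsCondense` at a given `U` (what the route's `closes` uses).

Nothing here closes the item; no definitions are introduced; no `sorry`.
-/

-- the mandated namespace `Summit.<Summit>.<Problem>.Theorems` repeats `HubbardSuperconductivity`
-- (single-problem summit, D-0017), which the `dupNamespace` linter flags on every declaration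
set_option linter.dupNamespace false

noncomputable section

namespace Summit.HubbardSuperconductivity.HubbardSuperconductivity.Theorems.ParentFirstSMA

open Matrix Literature.MathematicalPhysics.QuantumLattice
open Summit.HubbardSuperconductivity.HubbardSuperconductivity.Theses.ParentFirstSMA

/-! ### Real arithmetic and particle–hole bookkeeping -/

/-- The real-arithmetic heart of line `birth`: pole fraction `c Z ≤ w`, budget
`2f ≤ U Z − θ (U − 2μ) w`, particle–hole bookkeeping `Δ = U − 2μ` and the gap `g ≤ Δ` give
`2f ≤ (U − θ g c) Z`. [folklore] -/
theorem refill_budget_of_pole {U θ g c Z w f μ Δ : ℝ} (hθ : 0 < θ) (hg : 0 < g) (hc : 0 < c)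
    (hZ : 0 < Z) (hcw : c * Z ≤ w) (hf : 2 * f ≤ U * Z - θ * (U - 2 * μ) * w) (hΔ : Δ = U - 2 * μ)
    (hgap : g ≤ Δ) : 2 * f ≤ (U - θ * g * c) * Z := by
  have hw : 0 ≤ w := le_trans (mul_pos hc hZ).le hcw
  have h1 : g * w ≤ (U - 2 * μ) * w := mul_le_mul_of_nonneg_right (hΔ ▸ hgap) hw
  have h2 : θ * (g * w) ≤ θ * ((U - 2 * μ) * w) := mul_le_mul_of_nonneg_left h1 hθ.le
  have h3 : θ * g * (c * Z) ≤ θ * g * w := mul_le_mul_of_nonneg_left hcw (mul_pos hθ hg).le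
  nlinarith [h2, h3]

/-- Particle–hole bookkeeping on the even torus: for even `L ≥ 2` the Lieb–Wu charge gap at half filling
is `Δ_c(L) = U − 2 (E(L²) − E(L² − 1))`, from the proved identity `E(L² − 1) = E(L² + 1) − U`
(`groundEnergyAt_fermionTorus_particleHole`). [cite: LiebWuPhysicaA2003, §1 eq. (3)] -/
theorem chargeGap_eq_slack (U : ℝ) {L : ℕ} (hLe : Even L) (h2 : 2 ≤ L) :
    chargeGap (fermionTorusGraph 2 L) 1 U (L ^ 2) =
      U - 2 * (groundEnergyAt (fermionTorusGraph 2 L) 1 U (L ^ 2) -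
        groundEnergyAt (fermionTorusGraph 2 L) 1 U (L ^ 2 - 1)) := by
  have hL1 : 1 ≤ L ^ 2 := Nat.one_le_pow _ _ (by omega)
  have hph := groundEnergyAt_fermionTorus_particleHole (d := 2) hLe 1 U (N := L ^ 2 - 1) (by omega)
  have hK : 2 * L ^ 2 - (L ^ 2 - 1) = L ^ 2 + 1 := by
    generalize L ^ 2 = K at hL1 ⊢
    omega
  rw [hK] at hph
  have hcast : ((L : ℝ) ^ 2 - ((L ^ 2 - 1 : ℕ) : ℝ)) = 1 := by
    rw [Nat.cast_sub hL1]
    push_cast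
    ring
  rw [hcast, one_mul] at hph
  unfold chargeGap
  linarith [hph]

/-! ### The composition of line `birth` -/

/-- **Composition of line `birth`.** If (1) the half-filled Hubbard torus has an `L`-uniform charge gap
`g > 0` on the window `U ∈ [12, 24]` (the parent Mott gap — stub `stub_parentMottGap`), and (2) for every
such `U` some one-hole ground state `φ`, half-filled ground state `ψ₀` and momentum `k` give a refill wave
`Pφ` whose pole along `ψ₀` carries a fraction `c` of `‖Pφ‖²` and whose first moment undershoots the budget
`U‖Pφ‖²` by the fraction `θ` of the pole's slack (stub `stub_poleDominatedRefill`), then the crux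
`HoleSingleModeBelowHalfU` holds with `ε := θ·g·c`. Both hypotheses are the registered stub statements of
`Cruxes/HoleSingleModeBelowHalfU/Lines/birth.lean`, verbatim. [folklore] -/
theorem holeSingleModeBelowHalfU_of_gap_of_pole
    (hgap : ∀ U : ℝ, 12 ≤ U → U ≤ 24 → ∃ g : ℝ, 0 < g ∧ ∃ L₀ : ℕ, ∀ L : ℕ, L₀ ≤ L → Even L →
      g ≤ chargeGap (fermionTorusGraph 2 L) 1 U (L ^ 2))
    (hpole : ∀ U : ℝ, 12 ≤ U → U ≤ 24 → ∃ θ : ℝ, 0 < θ ∧ ∃ c : ℝ, 0 < c ∧ ∃ L₀ : ℕ, ∀ L : ℕ,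
      L₀ ≤ L → Even L →
      ∃ (k : Fin 2 → Fin L) (φ ψ₀ : Fock (Orb (FermionTorus 2 L))),
        IsGroundState (hubbardTorus 2 L 1 U) (L ^ 2 - 1) φ ∧ star φ ⬝ᵥ φ = 1 ∧
        IsGroundState (hubbardTorus 2 L 1 U) (L ^ 2) ψ₀ ∧ star ψ₀ ⬝ᵥ ψ₀ = 1 ∧
        ∀ P : Matrix (Finset (Orb (FermionTorus 2 L))) (Finset (Orb (FermionTorus 2 L))) ℂ,
          P = ∑ x : FermionTorus 2 L, Complex.exp (2 * Real.pi * Complex.I *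
              (∑ i : Fin 2, ((ofLex x i : ℕ) : ℂ) * ((k i : ℕ) : ℂ)) / (L : ℂ)) •
                (creation (orb x 1) * (1 - numberOp x 0)) →
          0 < (star (P *ᵥ φ) ⬝ᵥ (P *ᵥ φ)).re ∧
          c * (star (P *ᵥ φ) ⬝ᵥ (P *ᵥ φ)).re ≤ ‖star ψ₀ ⬝ᵥ (P *ᵥ φ)‖ ^ 2 ∧
          2 * (star (P *ᵥ φ) ⬝ᵥ ((hubbardTorus 2 L 1 0 * P - P * hubbardTorus 2 L 1 0) *ᵥ φ)).re ≤
            U * (star (P *ᵥ φ) ⬝ᵥ (P *ᵥ φ)).re -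
              θ * (U - 2 * (groundEnergyAt (fermionTorusGraph 2 L) 1 U (L ^ 2) -
                groundEnergyAt (fermionTorusGraph 2 L) 1 U (L ^ 2 - 1))) *
                  ‖star ψ₀ ⬝ᵥ (P *ᵥ φ)‖ ^ 2) :
    HoleSingleModeBelowHalfU := by
  intro U hU12 hU24
  obtain ⟨g, hg, L₁, hG⟩ := hgap U hU12 hU24
  obtain ⟨θ, hθ, c, hc, L₂, hP⟩ := hpole U hU12 hU24
  refine ⟨θ * g * c, by positivity, max (max L₁ L₂) 2, fun L hL hLe => ?_⟩
  have hL₁ : L₁ ≤ L := le_trans (le_trans (le_max_left _ _) (le_max_left _ _)) hL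
  have hL₂ : L₂ ≤ L := le_trans (le_trans (le_max_right _ _) (le_max_left _ _)) hL
  have h2 : 2 ≤ L := le_trans (le_max_right _ _) hL
  obtain ⟨k, φ, ψ₀, hgs, hnorm, -, -, hbody⟩ := hP L hL₂ hLe
  obtain ⟨hZ, hcw, hf⟩ := hbody _ rfl
  have hΔ := chargeGap_eq_slack U hLe h2
  have hgapL : g ≤ chargeGap (fermionTorusGraph 2 L) 1 U (L ^ 2) := hG L hL₁ hLe
  refine ⟨k, φ, hgs, hnorm, ?_⟩
  dsimp only
  exact ⟨hZ, refill_budget_of_pole hθ hg hc hZ hcw hf hΔ hgapL⟩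

/-! ### Necessity of the parent Mott gap -/

/-- **The crux implies the parent Mott gap on the window** (necessity of stub `stub_parentMottGap` for every
line of this crux): if `HoleSingleModeBelowHalfU` holds then for every `U ∈ [12, 24]` the half-filled Hubbard
torus has an `L`-uniform charge gap, `g ≤ chargeGap (fermionTorusGraph 2 L) 1 U (L²)` for all large even `L`,
with `g := ε`. Proof: the landed support `mottGapFromSingleMode_proof` gives `Z (U − Δ_c(L)) ≤ 2f`, the crux gives
`0 < Z` and `2f ≤ (U − ε) Z`, hence `ε ≤ Δ_c(L)`. This is the step of the route's deciding theorem `closes`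
isolated as a theorem: the crux is at least as strong as the two-dimensional Mott gap on `[12, 24]`.
[cite: LiebWuPhysicaA2003, §1 eq. (3)] -/
theorem parentMottGap_of_holeSingleModeBelowHalfU :
    open Matrix Literature.MathematicalPhysics.QuantumLattice in
    Summit.HubbardSuperconductivity.HubbardSuperconductivity.Theses.ParentFirstSMA.HoleSingleModeBelowHalfU →
    ∀ U : ℝ, 12 ≤ U → U ≤ 24 → ∃ g : ℝ, 0 < g ∧ ∃ L₀ : ℕ, ∀ L : ℕ, L₀ ≤ L → Even L →
      g ≤ chargeGap (fermionTorusGraph 2 L) 1 U (L ^ 2) := by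
  intro h U hU12 hU24
  obtain ⟨ε, hε, L₀, hL⟩ := h U hU12 hU24
  refine ⟨ε, hε, max L₀ 2, fun L hL' hLe => ?_⟩
  obtain ⟨k, φ, hgs, -, hZ, hf⟩ := hL L (le_trans (le_max_left _ _) hL') hLe
  have hm := mottGapFromSingleMode_proof U L k φ hLe (le_trans (le_max_right _ _) hL') hgs
  dsimp only at hm
  nlinarith [hm, hZ, hf]

/-- The same necessity in the exact shape consumed by the route: at every `U ∈ [12, 24]` the crux yields
hypothesis (a) of crux #4 `DiluteDWavePairsCondense` (the gapped parent), verbatim. [folklore] -/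
theorem diluteDWavePairsCondense_gap_hypothesis_of_holeSingleModeBelowHalfU (h : HoleSingleModeBelowHalfU)
    {U : ℝ} (hU12 : 12 ≤ U) (hU24 : U ≤ 24) :
    ∃ g : ℝ, 0 < g ∧ ∃ L₀ : ℕ, ∀ L : ℕ, L₀ ≤ L → Even L →
      g ≤ chargeGap (fermionTorusGraph 2 L) 1 U (L ^ 2) :=
  parentMottGap_of_holeSingleModeBelowHalfU h U hU12 hU24

end Summit.HubbardSuperconductivity.HubbardSuperconductivity.Theorems.ParentFirstSMA

end
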